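import Literature.AnabelianGeometry.SemiGraphs.PSCSmoothCurveShape
import HarnessLib

/-!
# [IUTchI] Rmk. 1.2.3 (iv), cuspidal half, forward direction at smooth-curve shape: genuine cusp groups satisfy the typed ramification condition and are maximal for it

Mochizuki, *Inter-universal Teichmüller theory I* [IUTchI] Rmk. 1.2.3 (iv) pp. 41–42 (replacement text
for [CombGC] Rmk. 1.4.3): "the cuspidal edge-like subgroups of `Π_G` may be characterized as the maximal
closed subgroups `A ⊆ Π_G` isomorphic to `ℤ_l` which satisfy the following condition: for every
characteristic open subgroup `Π_{G'} ⊆ Π_G` … `Π_{G''} := A · Π_{G'}` … the cyclic finite étale covering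
`G' → G''` is cuspidally totally ramified" — typed by abc-iut-L3-t4 as
`PSCDatum.CuspidalEdgeLikeCharacterization` (`PSCRamification.lean`; FACT-LIST row F-1931 over the origin
parameter). [cite: Mochizuki2012, IUTchI Rmk 1.2.3(iv) pp.41-42]

PROOF-ONLY file: at data of SMOOTH-CURVE shape (one vertex with `Π_v = Π`, no nodes, cusp groups the
closed cusp inertia subgroups along a pro-`Σ` completion `ι : Γ_{g,r} → Π`, `Π` profinite;
`PSCSmoothCurveShape.lean`) the FORWARD half of the characterization holds for GENUINE data: every
cuspidal subgroup `A = γ Π_c γ⁻¹` (i) is closed, (ii) is topologically generated by one element, (iii) is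
infinite, (iv) for EVERY characteristic open `U` makes `U ≤ A·U` a cuspidally totally ramified Galois
covering in the typed sense (`cuspidal_ramificationCondition_of_smoothCurve`), and (v) is MAXIMAL among
closed procyclic subgroups: a closed procyclic `B ⊇ A` is abelian, hence centralises a non-trivial
element of `A`, hence lies in `A` by the tree's `mem_cuspInertia_closure_of_commute` (malnormality of cusp
inertia, [SemiAnbd] Ex. 2.10 / [AbsAnab] Lem. 1.3.7) — `cuspidal_maximal_of_smoothCurve`.  Together:
`cuspidalEdgeLikeCharacterization_mp_of_smoothCurve`, the `→` half of the typed `iff` of F-1931 at every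
genuine smooth-curve datum, for every `Σ` (the typed `Σ = {l}` restriction is not needed for this half).
This is a SHAPE CHECK of the typed condition against genuine cusp groups (the kind of check that exposed
finding F-L3t4g5-1 on the verticial half); the converse half (every maximal such `A` is cuspidal) is the
anabelian content of the Remark and is NOT proved here.  No side is taken on [IUTchIII] Cor. 3.12.
-/

noncomputable section

namespace Literature.AnabelianGeometry.SemiGraphs

namespace PSCDatum

open scoped Pointwise
open Literature.GroupTheory.CombinatorialGroupTheory
open SemiGraphOfAnabelioids (IsProSigmaCompletion proSigmaCuspInertiaMalnormal_holds
  mem_cuspInertia_closure_of_commute)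

universe u

variable {P : Type u} [Group P] [TopologicalSpace P] [IsTopologicalGroup P]

/-! ### Conjugates of closed procyclic subgroups -/

/-- A conjugate of a closed subgroup is closed. [cite: MochizukiCombGC2007, Def 1.1(ii) p.6] -/
private theorem isClosed_conj_smul'' {A : Subgroup P} (hA : IsClosed (A : Set P)) (γ : ConjAct P) :
    IsClosed ((γ • A : Subgroup P) : Set P) := by
  have h : ((γ • A : Subgroup P) : Set P) = (fun x : P => γ⁻¹ • x) ⁻¹' (A : Set P) := by
    ext x
    rw [SetLike.mem_coe, Subgroup.mem_pointwise_smul_iff_inv_smul_mem]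
    rfl
  rw [h]
  refine hA.preimage ?_
  simp only [ConjAct.smul_def]
  fun_prop

omit [TopologicalSpace P] [IsTopologicalGroup P] in
/-- `γ • ⟨a⟩ = ⟨γ • a⟩`. [folklore] -/
private theorem smul_zpowers (γ : ConjAct P) (a : P) :
    γ • Subgroup.zpowers a = Subgroup.zpowers (γ • a) := by
  rw [Subgroup.pointwise_smul_def, MonoidHom.map_zpowers]
  rfl

/-- Conjugation carries the closure of `⟨a⟩` to the closure of `⟨γ • a⟩`. [folklore] -/
private theorem smul_topologicalClosure_zpowers (γ : ConjAct P) (a : P) :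
    γ • (Subgroup.zpowers a).topologicalClosure = (Subgroup.zpowers (γ • a)).topologicalClosure := by
  have key : ∀ (δ : ConjAct P) (b : P), δ • (Subgroup.zpowers b).topologicalClosure ≤
      (Subgroup.zpowers (δ • b)).topologicalClosure := by
    intro δ b x hx
    rw [Subgroup.mem_pointwise_smul_iff_inv_smul_mem] at hx
    have hcont : Continuous fun y : P => δ • y := by simp only [ConjAct.smul_def]; fun_prop
    have himg : (fun y : P => δ • y) '' ((Subgroup.zpowers b).topologicalClosure : Set P) ⊆
        ((Subgroup.zpowers (δ • b)).topologicalClosure : Set P) := by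
      rw [Subgroup.topologicalClosure_coe, Subgroup.topologicalClosure_coe]
      refine (image_closure_subset_closure_image hcont).trans (closure_mono ?_)
      rintro _ ⟨y, hy, rfl⟩
      rw [SetLike.mem_coe, ← smul_zpowers]
      exact Subgroup.smul_mem_pointwise_smul _ _ _ hy
    have := himg ⟨δ⁻¹ • x, hx, smul_inv_smul δ x⟩
    exact this
  refine le_antisymm (key γ a) ?_
  have h2 := key γ⁻¹ (γ • a)
  rw [inv_smul_smul] at h2
  intro x hx
  rw [Subgroup.mem_pointwise_smul_iff_inv_smul_mem]
  exact h2 (Subgroup.smul_mem_pointwise_smul _ _ _ hx)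

/-- The closure of a cyclic subgroup is commutative (Hausdorff group). [folklore] -/
private theorem comm_of_mem_topologicalClosure_zpowers [T2Space P] (b : P) {x y : P}
    (hx : x ∈ (Subgroup.zpowers b).topologicalClosure) (hy : y ∈ (Subgroup.zpowers b).topologicalClosure) :
    x * y = y * x := by
  have hs : ∀ u v : Subgroup.zpowers b, u * v = v * u := by
    rintro ⟨u, hu⟩ ⟨v, hv⟩
    obtain ⟨m, rfl⟩ := Subgroup.mem_zpowers_iff.mp hu
    obtain ⟨n, rfl⟩ := Subgroup.mem_zpowers_iff.mp hv
    exact Subtype.ext (zpow_mul_comm b m n)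
  letI := Subgroup.commGroupTopologicalClosure (Subgroup.zpowers b) hs
  have := mul_comm (⟨x, hx⟩ : (Subgroup.zpowers b).topologicalClosure) ⟨y, hy⟩
  exact congrArg Subtype.val this

/-! ### The forward half of the characterization at smooth-curve shape -/

section SmoothCurve

variable [CompactSpace P] [T2Space P] [TotallyDisconnectedSpace P]
variable {Sigma : Set ℕ} {g r : ℕ}

/-- **Cuspidal subgroups of a smooth-curve datum satisfy the ramification condition of [IUTchI]
Rmk. 1.2.3 (iv)**: closed, topologically procyclic, infinite, and for every characteristic open `U` the
covering `U ≤ A·U` is cuspidally totally ramified in the typed sense (Galois, and totally ramified at the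
cusp of `A` itself). [cite: Mochizuki2012, IUTchI Rmk 1.2.3(iv) pp.41-42] -/
theorem cuspidal_ramificationCondition_of_smoothCurve (hne : Sigma.Nonempty)
    (hprime : ∀ p ∈ Sigma, p.Prime) (h : PuncturedSurfaceGroup.IsHyperbolicType g r)
    (ι : PuncturedSurfaceGroup g r →* P) (hι : IsProSigmaCompletion Sigma ι) (G : PSCDatum P)
    (e : G.graph.C ≃ Fin r)
    (hC : ∀ c, G.cuspGp c =
      ((PuncturedSurfaceGroup.cuspInertia (g := g) (e c)).map ι).topologicalClosure)
    {A : Subgroup P} (hA : G.IsCuspidal A) :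
    IsClosed (A : Set P) ∧ (∃ a : P, (Subgroup.zpowers a).topologicalClosure = A) ∧
      (A : Set P).Infinite ∧
      ∀ U : Subgroup P, U.Characteristic → IsOpen (U : Set P) →
        G.IsCuspidallyTotallyRamified (A ⊔ U) U := by
  obtain ⟨c, γ, rfl⟩ := hA
  refine ⟨isClosed_conj_smul'' (G.isClosed_cuspGp c) γ, ⟨γ • ι (PuncturedSurfaceGroup.c (e c)), ?_⟩,
    ?_, fun U hU hUo => ?_⟩
  · rw [hC, PuncturedSurfaceGroup.cuspInertia, MonoidHom.map_zpowers, smul_topologicalClosure_zpowers]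
  · haveI := G.infinite_cuspGp hne hprime h ι hι e hC c
    haveI : Infinite (γ • G.cuspGp c : Subgroup P) :=
      Infinite.of_injective _ (Subgroup.equivSMul γ (G.cuspGp c)).injective
    exact Set.infinite_coe_iff.mp ‹Infinite (γ • G.cuspGp c : Subgroup P)›
  · refine ⟨⟨le_sup_right, hUo, Subgroup.isOpen_mono le_sup_right hUo,
      (inferInstance : U.Normal).subgroupOf _⟩, c, γ, ?_⟩
    rw [inf_eq_right.mpr le_sup_left]

/-- **Cuspidal subgroups of a smooth-curve datum are maximal among closed procyclic subgroups**: a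
closed procyclic `B ⊇ γ Π_c γ⁻¹` is abelian, so it centralises a non-trivial element of the (infinite)
cusp group and lies in it by malnormality of cusp inertia (`mem_cuspInertia_closure_of_commute`).
[cite: Mochizuki2012, IUTchI Rmk 1.2.3(iv) pp.41-42] -/
theorem cuspidal_maximal_of_smoothCurve (hne : Sigma.Nonempty)
    (hprime : ∀ p ∈ Sigma, p.Prime) (h : PuncturedSurfaceGroup.IsHyperbolicType g r)
    (ι : PuncturedSurfaceGroup g r →* P) (hι : IsProSigmaCompletion Sigma ι) (G : PSCDatum P)
    (e : G.graph.C ≃ Fin r)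
    (hC : ∀ c, G.cuspGp c =
      ((PuncturedSurfaceGroup.cuspInertia (g := g) (e c)).map ι).topologicalClosure)
    {A : Subgroup P} (hA : G.IsCuspidal A) {B : Subgroup P}
    (hB : ∃ b : P, (Subgroup.zpowers b).topologicalClosure = B) (hAB : A ≤ B) : A = B := by
  obtain ⟨c, γ, rfl⟩ := hA
  obtain ⟨b, rfl⟩ := hB
  refine le_antisymm hAB fun x hx => ?_
  -- a non-trivial element of the infinite cusp group
  set I := ((PuncturedSurfaceGroup.cuspInertia (g := g) (e c)).map ι).topologicalClosure with hI
  haveI : Infinite I := (proSigmaCuspInertiaMalnormal_holds Sigma hne hprime g r h P ι hι (e c) (e c)).1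
  obtain ⟨⟨y, hyI⟩, hy1⟩ := exists_ne (1 : I)
  have hy1' : y ≠ 1 := fun h' => hy1 (Subtype.ext h')
  -- `γ • y ∈ A ≤ B` commutes with `x ∈ B`
  have hγy : γ • y ∈ γ • G.cuspGp c := by
    rw [hC]; exact Subgroup.smul_mem_pointwise_smul _ _ _ hyI
  have hcomm : x * (γ • y) = (γ • y) * x :=
    comm_of_mem_topologicalClosure_zpowers b hx (hAB hγy)
  -- conjugate back by `γ⁻¹`
  have hcomm' : Commute (γ⁻¹ • x) y := by
    have := congrArg (fun z : P => γ⁻¹ • z) hcomm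
    simp only [smul_mul', inv_smul_smul] at this
    exact this
  have hmem := mem_cuspInertia_closure_of_commute hne hprime h ι hι (e c) hyI hy1' hcomm'
  rw [hC, Subgroup.mem_pointwise_smul_iff_inv_smul_mem]
  exact hmem

/-- **[IUTchI] Rmk. 1.2.3 (iv), cuspidal half, FORWARD direction at smooth-curve shape**: every
cuspidal subgroup of a genuine smooth-curve datum satisfies the typed condition (for every `Σ`) and is
maximal among the subgroups satisfying it — the `→` half of `CuspidalEdgeLikeCharacterization`'s `iff`.
The `←` half is the anabelian content of the Remark and is not proved here.
[cite: Mochizuki2012, IUTchI Rmk 1.2.3(iv) pp.41-42] -/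
theorem cuspidalEdgeLikeCharacterization_mp_of_smoothCurve (hne : Sigma.Nonempty)
    (hprime : ∀ p ∈ Sigma, p.Prime) (h : PuncturedSurfaceGroup.IsHyperbolicType g r)
    (ι : PuncturedSurfaceGroup g r →* P) (hι : IsProSigmaCompletion Sigma ι) (G : PSCDatum P)
    (e : G.graph.C ≃ Fin r)
    (hC : ∀ c, G.cuspGp c =
      ((PuncturedSurfaceGroup.cuspInertia (g := g) (e c)).map ι).topologicalClosure)
    (A : Subgroup P) (hA : G.IsCuspidal A) :
    (IsClosed (A : Set P) ∧ (∃ a : P, (Subgroup.zpowers a).topologicalClosure = A) ∧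
        (A : Set P).Infinite ∧
        ∀ U : Subgroup P, U.Characteristic → IsOpen (U : Set P) →
          G.IsCuspidallyTotallyRamified (A ⊔ U) U) ∧
      ∀ B : Subgroup P,
        (IsClosed (B : Set P) ∧ (∃ b : P, (Subgroup.zpowers b).topologicalClosure = B) ∧
            (B : Set P).Infinite ∧
            ∀ U : Subgroup P, U.Characteristic → IsOpen (U : Set P) →
              G.IsCuspidallyTotallyRamified (B ⊔ U) U) →
          A ≤ B → A = B :=
  ⟨G.cuspidal_ramificationCondition_of_smoothCurve hne hprime h ι hι e hC hA,
    fun _ hB hAB => G.cuspidal_maximal_of_smoothCurve hne hprime h ι hι e hC hA hB.2.1 hAB⟩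

end SmoothCurve

end PSCDatum

end Literature.AnabelianGeometry.SemiGraphs

end
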